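import Summits.ResolutionOfSingularities.ResolutionOfSingularities.Theorems.EquisingularLiftEquisingularLiftNatFrameChange
import HarnessLib

/-!
# [OURS · L1 W4.5(b) · EL♮(3)] (δ) D2 FRAME-CHANGE, part 2 — D1's per-point clauses in the adapted frame: B6c's `hcen`, `hexact`,
# `hΦu / hregu`, `hΦv / hregv` (pointed) for the substituted form `Φ' = Φ ∘ θ`
# (crux `EquisingularLiftNatThree` stmt-ResolutionOfSingularities-20148 / parent 20038; rung v7′ TC⁺⁺, STEP 0 per subset)

NOT a statement of any manuscript. Helper file of the chain res-L1-w45b (cell `res-hironaka`, LADDER-RESOLUTION rung L, slot W4.5(b));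
OURS; AI-written, weaker than expert review; `--supports stmt-ResolutionOfSingularities-20148 --as helper` by res-L1-w45b-stub-3 (brick D2 of
`L/res-L1-w45b-stub-3/DELTA-PLAN.md`, part 2; part 1 = …NatFrameChange: the frame, the substitution, the dehomogenisation dictionary).
No `sorry`; standard axioms; no definitions.

WHAT. For a cluster point on chart `i` with lifted affine coordinates `a : {j ≠ i} → O` and the frame substitution `θ` (`θ_i = X 0`,
`θ_{i⁺l} = X (l+1) + a_l X 0`, hypotheses `hθi / hθs`), the clauses (δ) D1 `exists_clusterConeLift_subset` (p548257) delivers at that point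
become the binders of res-L1-w45b-stub-3's B6c ★ `tcPlus_centredPackage_of_axisSection_over` (…NatCentredPackageFrameOver) for `Φ' = aeval θ Φ`:
* **`frameSubst_centred`** — `dehomogenize i Φ ∈ (X_j − a_j)^m` ⟹ `∀ α ∈ Φ'.support, m ≤ α 1 + α 2`;
* **`frameSubst_exact`** — a unit coefficient of `(dehomogenize i Φ)(X + a)` in degree `m` ⟹ `∃ α ∈ Φ'.support, α 1 + α 2 = m ∧ IsUnit (Φ'.coeff α)`;
* **`frameSubst_stChart`** (any exceptional variable `X l₀`, `p = i⁺l₀`) and its specialisations **`frameSubst_chartU`** (`Φ'(1,X,XY) = X^m Φu`,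
  `O[X,Y]/(Φu)` regular at the primes `∋ C ϖ, X 0`) / **`frameSubst_chartV`** (`Φ'(1,XY,Y) = Y^m Φv`, primes `∋ C ϖ, X 1`).

References: res-L1-w45b-stub-3 p548257 (D1), …NatFrameChange (part 1), p539780 (`aeval_subst_zero_aeval_dehom`, `aeval_subst_one_aeval_dehom`);
typed port `Literature.AlgebraicGeometry.Resolution.Dehomogenization` [cite: CossartPiltant2008, proof of Prop. 4.2]; Mathlib
`MvPolynomial.mem_pow_idealOfVars_iff`.
-/

set_option linter.dupNamespace false -- mandated namespace `Summit.<Summit>.<Problem>` of this single-conjunct summit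

noncomputable section

namespace Summit.ResolutionOfSingularities.ResolutionOfSingularities.Cruxes.EquisingularLiftNat.Sections.TCPlus

open MvPolynomial IsLocalRing Literature.AlgebraicGeometry.Resolution

/-! ## Centred and exact clauses in the adapted frame -/

section Clauses

variable {O : Type*} [CommRing O] (i : Fin 3) (a : {j : Fin 3 // j ≠ i} → O)
  (θ : Fin 3 → MvPolynomial (Fin 3) O) (hθi : θ i = X 0)
  (hθs : ∀ l : Fin 2, θ (i.succAbove l) = X l.succ + C (a ⟨i.succAbove l, Fin.succAbove_ne i l⟩) * X 0)

include hθi hθs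

/-- **(δ) D2 — CENTRED transfers**: if `dehomogenize i Φ ∈ (X_j − a_j : j ≠ i) ^ m` (D1's clause) then every monomial of the substituted
form `Φ' = Φ ∘ θ` has `X 1, X 2`-degree at least `m` (B6c's `hcen`). [folklore] [OURS · L1 W4.5b] -/
theorem frameSubst_centred {Φ : MvPolynomial (Fin 3) O} {d m : ℕ} (hΦ : Φ.IsHomogeneous d)
    (hcen : dehomogenize i Φ ∈
      (Ideal.span (Set.range fun j => (X j : MvPolynomial {j : Fin 3 // j ≠ i} O) - C (a j))) ^ m) :
    ∀ α ∈ (aeval θ Φ).support, m ≤ α 1 + α 2 := by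
  classical
  intro α hα
  have hΦ' := isHomogeneous_aeval_frameSubst i a θ hθi hθs hΦ
  have hΨ : aeval (![1, X 0, X 1] : Fin 3 → MvPolynomial (Fin 2) O) (aeval θ Φ) ∈ idealOfVars (Fin 2) O ^ m := by
    rw [aeval_dehomZero_aeval_frameSubst i a θ hθi hθs]
    exact rename_mem_pow_idealOfVars _ (aeval_shift_mem_pow_idealOfVars a hcen)
  rw [aeval_dehomZero_eq_rename_dehomogenize, MvPolynomial.mem_pow_idealOfVars_iff] at hΨ
  have hαd : α.degree = d := by
    rw [Finsupp.degree_eq_weight_one]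
    exact hΦ' (MvPolynomial.mem_support_iff.mp hα)
  have hβ : coeff (Finsupp.mapDomain (fun j => (finSuccAboveEquiv (0 : Fin 3)).symm j) (α.subtypeDomain (· ≠ (0 : Fin 3))))
      (rename (fun j => (finSuccAboveEquiv (0 : Fin 3)).symm j) (dehomogenize 0 (aeval θ Φ))) = coeff α (aeval θ Φ) := by
    rw [MvPolynomial.coeff_rename_mapDomain _ (finSuccAboveEquiv (0 : Fin 3)).symm.injective,
      coeff_dehomogenize_of_isHomogeneous 0 hΦ' hαd]
  have hmem := hΨ _ (by rw [MvPolynomial.mem_support_iff, hβ]; exact MvPolynomial.mem_support_iff.mp hα)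
  rwa [degree_mapDomain_subtypeDomain] at hmem

/-- **(δ) D2 — EXACT transfers**: a unit coefficient in degree `m` of D1's shifted dehomogenisation `(dehomogenize i Φ)(X + a)`
is a unit coefficient of the substituted form `Φ' = Φ ∘ θ` at a monomial of `X 1, X 2`-degree `m` (B6c's `hexact`). [folklore]
[OURS · L1 W4.5b] -/
theorem frameSubst_exact [Nontrivial O] {Φ : MvPolynomial (Fin 3) O} {d m : ℕ} (hΦ : Φ.IsHomogeneous d)
    (hex : ∃ α : {j : Fin 3 // j ≠ i} →₀ ℕ, α.degree = m ∧
      IsUnit (coeff α (aeval (fun l => (X l : MvPolynomial {j : Fin 3 // j ≠ i} O) + C (a l)) (dehomogenize i Φ)))) :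
    ∃ α ∈ (aeval θ Φ).support, α 1 + α 2 = m ∧ IsUnit ((aeval θ Φ).coeff α) := by
  classical
  obtain ⟨α₀, hα₀, hu⟩ := hex
  have hΦ' := isHomogeneous_aeval_frameSubst i a θ hθi hθs hΦ
  -- the exponent of `Φ'(1, X 0, X 1)` carrying the unit, and its preimage in `{j ≠ 0} →₀ ℕ`
  set β : Fin 2 →₀ ℕ := Finsupp.mapDomain (fun j => (finSuccAboveEquiv i).symm j) α₀ with hβdef
  set γ : {j : Fin 3 // j ≠ (0 : Fin 3)} →₀ ℕ := Finsupp.mapDomain (finSuccAboveEquiv (0 : Fin 3)) β with hγdef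
  have hγβ : Finsupp.mapDomain (fun j => (finSuccAboveEquiv (0 : Fin 3)).symm j) γ = β := by
    rw [hγdef, ← Finsupp.mapDomain_comp]
    convert Finsupp.mapDomain_id using 2
    funext l
    exact (finSuccAboveEquiv (0 : Fin 3)).symm_apply_apply l
  have hcoeff : coeff γ (dehomogenize 0 (aeval θ Φ)) =
      coeff α₀ (aeval (fun l => (X l : MvPolynomial {j : Fin 3 // j ≠ i} O) + C (a l)) (dehomogenize i Φ)) := by
    rw [← MvPolynomial.coeff_rename_mapDomain _ (finSuccAboveEquiv (0 : Fin 3)).symm.injective, hγβ,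
      ← aeval_dehomZero_eq_rename_dehomogenize, aeval_dehomZero_aeval_frameSubst i a θ hθi hθs, hβdef,
      MvPolynomial.coeff_rename_mapDomain _ (finSuccAboveEquiv i).symm.injective]
  have hne : coeff γ (dehomogenize 0 (aeval θ Φ)) ≠ 0 := by
    rw [hcoeff]
    exact hu.ne_zero
  obtain ⟨α, hα, hαγ⟩ := exists_mem_support_of_coeff_dehomogenize_ne_zero 0 (aeval θ Φ) γ hne
  have hαd : α.degree = d := by
    rw [Finsupp.degree_eq_weight_one]
    exact hΦ' (MvPolynomial.mem_support_iff.mp hα)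
  refine ⟨α, hα, ?_, ?_⟩
  · rw [← degree_mapDomain_subtypeDomain, hαγ, hγβ, hβdef, Finsupp.degree_mapDomain, hα₀]
  · rw [← coeff_dehomogenize_of_isHomogeneous 0 hΦ' hαd, hαγ, hcoeff]
    exact hu

/-- **(δ) D2 — STRICT-TRANSFORM CHART transfers**: D1's chart clause at the exceptional variable `X_p`, `p = i⁺l₀`, for the
shifted dehomogenisation — `X_p ^ m · Φst = (…)(X_p, X_p X_j)` with `O[…]/(Φst)` regular at the primes containing `C ϖ` and `X_p` —
gives the chart clause of `Φ' = Φ ∘ θ` at `X l₀` with the same POINTED regularity. [folklore] [OURS · L1 W4.5b] -/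
theorem frameSubst_stChart (ϖ : O) (Φ : MvPolynomial (Fin 3) O) (m : ℕ) (l₀ : Fin 2)
    (Φst : MvPolynomial {j : Fin 3 // j ≠ i} O)
    (hst : (X ⟨i.succAbove l₀, Fin.succAbove_ne i l₀⟩ : MvPolynomial {j : Fin 3 // j ≠ i} O) ^ m * Φst =
      aeval (fun j => if j = ⟨i.succAbove l₀, Fin.succAbove_ne i l₀⟩ then
          (X ⟨i.succAbove l₀, Fin.succAbove_ne i l₀⟩ : MvPolynomial {j : Fin 3 // j ≠ i} O)
        else X ⟨i.succAbove l₀, Fin.succAbove_ne i l₀⟩ * X j)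
        (aeval (fun l => (X l : MvPolynomial {j : Fin 3 // j ≠ i} O) + C (a l)) (dehomogenize i Φ)))
    (hreg : ∀ (Q : Ideal (MvPolynomial {j : Fin 3 // j ≠ i} O ⧸ Ideal.span {Φst})) [Q.IsPrime],
      Ideal.Quotient.mk (Ideal.span {Φst}) (C ϖ : MvPolynomial {j : Fin 3 // j ≠ i} O) ∈ Q →
      Ideal.Quotient.mk (Ideal.span {Φst}) (X ⟨i.succAbove l₀, Fin.succAbove_ne i l₀⟩ : MvPolynomial {j : Fin 3 // j ≠ i} O) ∈ Q →
      IsRegularLocalRing (Localization.AtPrime Q)) :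
    ∃ Φn : MvPolynomial (Fin 2) O,
      aeval (R := O) (fun l : Fin 2 => if l = l₀ then (X l₀ : MvPolynomial (Fin 2) O) else X l₀ * X l)
          (aeval (![1, X 0, X 1] : Fin 3 → MvPolynomial (Fin 2) O) (aeval θ Φ)) = X l₀ ^ m * Φn ∧
      ∀ (Q : Ideal (MvPolynomial (Fin 2) O ⧸ Ideal.span {Φn})) [Q.IsPrime],
        Ideal.Quotient.mk (Ideal.span {Φn}) (C ϖ : MvPolynomial (Fin 2) O) ∈ Q →
        Ideal.Quotient.mk (Ideal.span {Φn}) (X l₀ : MvPolynomial (Fin 2) O) ∈ Q →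
        IsRegularLocalRing (Localization.AtPrime Q) := by
  classical
  -- notation
  set p : {j : Fin 3 // j ≠ i} := ⟨i.succAbove l₀, Fin.succAbove_ne i l₀⟩ with hp
  set η : {j : Fin 3 // j ≠ i} → Fin 2 := fun j => (finSuccAboveEquiv i).symm j with hη
  have hηp : η p = l₀ := finSuccAboveEquiv_symm_apply_succAbove i l₀ _
  have hηinj : Function.Injective η := (finSuccAboveEquiv i).symm.injective
  -- the chart substitutions commute with the re-indexing
  have hcomm : ∀ ψ : MvPolynomial {j : Fin 3 // j ≠ i} O,
      aeval (R := O) (fun l : Fin 2 => if l = l₀ then (X l₀ : MvPolynomial (Fin 2) O) else X l₀ * X l) (rename η ψ) =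
        rename η (aeval (fun j => if j = p then (X p : MvPolynomial {j : Fin 3 // j ≠ i} O) else X p * X j) ψ) := by
    intro ψ
    have hfun : ((fun l : Fin 2 => if l = l₀ then (X l₀ : MvPolynomial (Fin 2) O) else X l₀ * X l) ∘ η) =
        fun j => rename η (if j = p then (X p : MvPolynomial {j : Fin 3 // j ≠ i} O) else X p * X j) := by
      funext j
      by_cases hj : j = p
      · rw [hj, Function.comp_apply, hηp, if_pos rfl, if_pos rfl, MvPolynomial.rename_X, hηp]
      · have hηj : η j ≠ l₀ := fun h => hj (hηinj (h.trans hηp.symm))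
        rw [Function.comp_apply, if_neg hηj, if_neg hj, map_mul, MvPolynomial.rename_X, MvPolynomial.rename_X, hηp]
    rw [MvPolynomial.aeval_rename, MvPolynomial.comp_aeval_apply (φ := rename η), hfun]
  refine ⟨rename η Φst, ?_, ?_⟩
  · rw [aeval_dehomZero_aeval_frameSubst i a θ hθi hθs, hcomm, ← hst, map_mul, map_pow, MvPolynomial.rename_X, hηp]
  · intro Q _ hϖQ hXQ
    -- the re-indexing `O[X_j : j ≠ i] ≃ O[X 0, X 1]` descends to the quotients
    let ρ : MvPolynomial {j : Fin 3 // j ≠ i} O ≃+* MvPolynomial (Fin 2) O :=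
      (MvPolynomial.renameEquiv O (finSuccAboveEquiv i).symm).toRingEquiv
    have hρ : ∀ x, ρ x = rename η x := fun x => rfl
    have hIJ : Ideal.span {rename η Φst} = (Ideal.span {Φst}).map (ρ : MvPolynomial {j : Fin 3 // j ≠ i} O →+* _) := by
      rw [Ideal.map_span, Set.image_singleton]
      rfl
    let ρq := Ideal.quotientEquiv (Ideal.span {Φst}) (Ideal.span {rename η Φst}) ρ hIJ
    haveI : (Q.comap ρq.toRingHom).IsPrime := Ideal.comap_isPrime _ _
    refine isRegularLocalRing_atPrime_of_ringEquiv ρq (Q.comap ρq.toRingHom) Q (fun x => by rw [Ideal.mem_comap]; rfl)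
      (hreg _ ?_ ?_)
    · rw [Ideal.mem_comap, RingEquiv.toRingHom_eq_coe, RingHom.coe_coe, Ideal.quotientEquiv_mk, hρ, MvPolynomial.rename_C]
      exact hϖQ
    · rw [Ideal.mem_comap, RingEquiv.toRingHom_eq_coe, RingHom.coe_coe, Ideal.quotientEquiv_mk, hρ, MvPolynomial.rename_X,
        hηp]
      exact hXQ

/-- **(δ) D2 — chart `u`** (`l₀ = 0`): B6c's `hΦu` / pointed `hregu` for the substituted form. [folklore] [OURS · L1 W4.5b] -/
theorem frameSubst_chartU (ϖ : O) (Φ : MvPolynomial (Fin 3) O) (m : ℕ) (Φst : MvPolynomial {j : Fin 3 // j ≠ i} O)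
    (hst : (X ⟨i.succAbove 0, Fin.succAbove_ne i 0⟩ : MvPolynomial {j : Fin 3 // j ≠ i} O) ^ m * Φst =
      aeval (fun j => if j = ⟨i.succAbove 0, Fin.succAbove_ne i 0⟩ then
          (X ⟨i.succAbove 0, Fin.succAbove_ne i 0⟩ : MvPolynomial {j : Fin 3 // j ≠ i} O)
        else X ⟨i.succAbove 0, Fin.succAbove_ne i 0⟩ * X j)
        (aeval (fun l => (X l : MvPolynomial {j : Fin 3 // j ≠ i} O) + C (a l)) (dehomogenize i Φ)))
    (hreg : ∀ (Q : Ideal (MvPolynomial {j : Fin 3 // j ≠ i} O ⧸ Ideal.span {Φst})) [Q.IsPrime],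
      Ideal.Quotient.mk (Ideal.span {Φst}) (C ϖ : MvPolynomial {j : Fin 3 // j ≠ i} O) ∈ Q →
      Ideal.Quotient.mk (Ideal.span {Φst}) (X ⟨i.succAbove 0, Fin.succAbove_ne i 0⟩ : MvPolynomial {j : Fin 3 // j ≠ i} O) ∈ Q →
      IsRegularLocalRing (Localization.AtPrime Q)) :
    ∃ Φu : MvPolynomial (Fin 2) O,
      aeval (![1, X 0, X 0 * X 1] : Fin 3 → MvPolynomial (Fin 2) O) (aeval θ Φ) = X 0 ^ m * Φu ∧
      ∀ (Q : Ideal (MvPolynomial (Fin 2) O ⧸ Ideal.span {Φu})) [Q.IsPrime],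
        Ideal.Quotient.mk (Ideal.span {Φu}) (C ϖ : MvPolynomial (Fin 2) O) ∈ Q →
        Ideal.Quotient.mk (Ideal.span {Φu}) (X 0 : MvPolynomial (Fin 2) O) ∈ Q →
        IsRegularLocalRing (Localization.AtPrime Q) := by
  obtain ⟨Φu, hΦu, hregu⟩ := frameSubst_stChart i a θ hθi hθs ϖ Φ m 0 Φst hst hreg
  exact ⟨Φu, by rw [← aeval_subst_zero_aeval_dehom, hΦu], hregu⟩

/-- **(δ) D2 — chart `v`** (`l₀ = 1`): B6c's `hΦv` / pointed `hregv` for the substituted form. [folklore] [OURS · L1 W4.5b] -/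
theorem frameSubst_chartV (ϖ : O) (Φ : MvPolynomial (Fin 3) O) (m : ℕ) (Φst : MvPolynomial {j : Fin 3 // j ≠ i} O)
    (hst : (X ⟨i.succAbove 1, Fin.succAbove_ne i 1⟩ : MvPolynomial {j : Fin 3 // j ≠ i} O) ^ m * Φst =
      aeval (fun j => if j = ⟨i.succAbove 1, Fin.succAbove_ne i 1⟩ then
          (X ⟨i.succAbove 1, Fin.succAbove_ne i 1⟩ : MvPolynomial {j : Fin 3 // j ≠ i} O)
        else X ⟨i.succAbove 1, Fin.succAbove_ne i 1⟩ * X j)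
        (aeval (fun l => (X l : MvPolynomial {j : Fin 3 // j ≠ i} O) + C (a l)) (dehomogenize i Φ)))
    (hreg : ∀ (Q : Ideal (MvPolynomial {j : Fin 3 // j ≠ i} O ⧸ Ideal.span {Φst})) [Q.IsPrime],
      Ideal.Quotient.mk (Ideal.span {Φst}) (C ϖ : MvPolynomial {j : Fin 3 // j ≠ i} O) ∈ Q →
      Ideal.Quotient.mk (Ideal.span {Φst}) (X ⟨i.succAbove 1, Fin.succAbove_ne i 1⟩ : MvPolynomial {j : Fin 3 // j ≠ i} O) ∈ Q →
      IsRegularLocalRing (Localization.AtPrime Q)) :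
    ∃ Φv : MvPolynomial (Fin 2) O,
      aeval (![1, X 0 * X 1, X 1] : Fin 3 → MvPolynomial (Fin 2) O) (aeval θ Φ) = X 1 ^ m * Φv ∧
      ∀ (Q : Ideal (MvPolynomial (Fin 2) O ⧸ Ideal.span {Φv})) [Q.IsPrime],
        Ideal.Quotient.mk (Ideal.span {Φv}) (C ϖ : MvPolynomial (Fin 2) O) ∈ Q →
        Ideal.Quotient.mk (Ideal.span {Φv}) (X 1 : MvPolynomial (Fin 2) O) ∈ Q →
        IsRegularLocalRing (Localization.AtPrime Q) := by
  obtain ⟨Φv, hΦv, hregv⟩ := frameSubst_stChart i a θ hθi hθs ϖ Φ m 1 Φst hst hreg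
  exact ⟨Φv, by rw [← aeval_subst_one_aeval_dehom, hΦv], hregv⟩

end Clauses

end Summit.ResolutionOfSingularities.ResolutionOfSingularities.Cruxes.EquisingularLiftNat.Sections.TCPlus

end
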